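import Summits.ABC.StewartYu.DescentThirdQ
import Summits.ABC.StewartYu.DescentStepQ
import Literature.NumberTheory.Transcendental.PadicCW77Functions
import HarnessLib

/-!
# Cell abc-stewartyu, W80Two (iv): the TRIADIC level structure of the `q = 3` descent in the
# sign-free set-up — scale `3^{J₀−J}`, boxes, points, classes, invariant

`Summits/ABC/StewartYu/DescentLevelsThirdQ.lean` — cell `abc-stewartyu` (HOME
`run/shared/lean/pub/abc-stewartyu/`, seat p2; route `PadicPrimesW80TwoThirds`, crux `W80Two`
stmt-ABC-19486; decision D₃ of 2026-08-26: triadic twins as NEW declarations alongside the dyadic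
ones, no mutation).  Plain definitions and theorems on p3's sign-free datum `Q : SetupQ`; PLACE-FREE
(no `p`-adic field here): the `ℚ₂`-side objects (`wOf₃`, `Dw₃`, the functions) are lit's
`PadicTwoFunctions.lean`, which reads the rational values below through `PadicCW77.Setup.DwQ`.

This is the base-`3` twin of the level structure of the tree's Cijsouw–Waldschmidt development
(`CijsouwWaldschmidt1977Setup.lean` :459–:524, `CijsouwWaldschmidt1977Steps.lean` §§ Boxes /
Re-indexing / Parities / Inv / descent_algebra, p3's `DescentStepQ.lean`), in which every `2^J`
becomes `3^J`, "odd `s`" becomes "`3 ∤ s`", the half points `s/2` become the third points `s/3`,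
and the `2^{d+1}` square classes become the `3^{d+1}` cube classes of lit's `DescentThirdQ.lean`:

* `SetupQ.qΔ3 J₀ J u τ₀ s := DwQ (3^{J₀−J}) r l h τ₀ s` — the rational value of the `Δ`-factor
  `(d/dz)^{τ₀}[w_ρ(3^{J₀−J} z)]` at the natural point `s` (so lit's `Dw₃_natCast` is definitional);
  the scale identities `DwQ_eq_pow_mul_eval` (`DwQ c … k x = cᵏ (dᵏw)(cx)`), `DwQ_three_mul_div_three`
  (`DwQ (3c) k (x/3) = 3ᵏ DwQ c k x`), `qΔ3_third` (`qΔ3_J` at `s/3` is `3^{τ₀} qΔ3_{J+1}(s)`),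
  `qΔ3_top_eq` (`J = J₀`: a Hasse derivative of `wPolyQ`);
* `qTerm3 = qΔ3 · qA♭ · qE`, `coreSum3 = ∑ p(u) qTerm3` (the signed rational core of `φ_{J,τ}(s)`);
* `box3 L Lθ J` (`λⱼ ≤ Lⱼ/3ᴶ`, `λ_θ ≤ L_θ/3ᴶ`), `mem_box3`, `mem_box3_succ_of_reidx3`,
  `third_mem_box3_succ`, `mem_box3_top_iff`; the points `Pts3 N = {s < N : 3 ∤ s}` and their count;
* the class pattern `clsPat3 ε ε_θ s` of a residue vector and `cls3_eq_clsPat3_iff` (for `3 ∤ s` the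
  class of `u` at `s` is the pattern of `u`'s residues mod `3`), `sum_class3_eq_sum_reidx3`;
* the recentring constants `cγ3 = (εⱼ + ε_θ βⱼ)/3`, `γ_reidx3` (`γⱼ(ε + 3μ) = 3(γⱼ(μ) + cⱼ)`),
  `qA_reidx3`, `qΔ3_reidx3`;
* `SetupQ.Inv3` — the induction invariant at level `J` (support in `box3 J`, not all zero,
  `|p(u)| ≤ P`, `coreSum3_{J,τ}(s) = 0` for `s < 3ᴶ S₀`, `3 ∤ s`, `|τ| < T/3ᴶ`);

The step of the descent (`descent_algebra3`) and the endgame (`w80_endgame3`) are in the sequel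
`DescentStepThirdQ.lean`.

Everything is [folklore] book-keeping on [Yu1989, §3] / [CijsouwWaldschmidt1977, §4]; nothing here
is claimed to be in print in this form.

## References
* [Yu1989] K. Yu, *Linear forms in p-adic logarithms*, Acta Arith. 53 (1989), §3 (the `q`-descent,
  Lemmas 3.3–3.5).
* [CijsouwWaldschmidt1977] P. L. Cijsouw, M. Waldschmidt, Compositio Math. 34 (1977), §4 (pp. 184–191).
* [Waldschmidt1980] M. Waldschmidt, Acta Arith. 37 (1980), §3.5 (p. 274).
-/

noncomputable section

open Finset Polynomial
open Literature.NumberTheory.Transcendental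
open Literature.NumberTheory.Transcendental.CW77
open Literature.NumberTheory.Transcendental.CW77.Setup (Idx Tau tauNorm)
open Literature.NumberTheory.Transcendental.PadicCW77.Setup (DwQ)
open Literature.NumberTheory.Transcendental.Waldschmidt1980 (wScaled wPolyQ)

namespace Summit.ABC.StewartYu

/-! ### The scale identities of the rational value factor `DwQ` -/

/-- **`DwQ c a b h k x = cᵏ · (dᵏ w_{a,b})(c x)`** (chain rule for `w(cX)`). [folklore] -/
theorem DwQ_eq_pow_mul_eval (c a b h k : ℕ) (x : ℚ) :
    DwQ c a b h k x = (c : ℚ) ^ k * (derivative^[k] (wPolyQ a b h)).eval ((c : ℚ) * x) := by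
  unfold PadicCW77.Setup.DwQ Waldschmidt1980.wScaled
  rw [Waldschmidt1980.iterate_derivative_comp_C_mul_X', eval_mul, eval_C, eval_comp, eval_mul,
    eval_C, eval_X]

/-- **The third-point identity of the `Δ`-factor**: `DwQ (3c) a b h k (x/3) = 3ᵏ · DwQ c a b h k x`
(the polynomial `w(3c · X)` at `x/3` is `w(c X)` at `x`, and each derivative in `X` costs a factor `3`).
[cite: Yu1989, §3] -/
theorem DwQ_three_mul_div_three (c a b h k : ℕ) (x : ℚ) :
    DwQ (3 * c) a b h k (x / 3) = (3 : ℚ) ^ k * DwQ c a b h k x := by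
  rw [DwQ_eq_pow_mul_eval, DwQ_eq_pow_mul_eval]
  push_cast
  rw [mul_pow, show (3 : ℚ) * (c : ℚ) * (x / 3) = (c : ℚ) * x by ring]
  ring

/-- `DwQ 1 a b h k x = k! · ((1/k!) dᵏ w_{a,b})(x)` (no rescaling at the top level). [folklore] -/
theorem DwQ_one (a b h k : ℕ) (x : ℚ) :
    DwQ 1 a b h k x = (k.factorial : ℚ) * (hasseDeriv k (wPolyQ a b h)).eval x := by
  rw [DwQ_eq_pow_mul_eval, Nat.cast_one, one_pow, one_mul, one_mul,
    Waldschmidt1980.iterate_derivative_eval_eq_factorial_mul_hasseDeriv_eval]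

namespace SetupQ

variable (Q : SetupQ) {h Lb : ℕ}

/-! ### The rational cores at base `3` -/

/-- **The rational value of the `Δ`-factor at level `J` of the triadic descent** with finest level
`J₀`: `qΔ3 = (d/dX)^{τ₀}[w_ρ(3^{J₀−J} X)](s)`, `w_ρ = Δ(X;r)Δ(X;h)ˡ`, through the scale-generic
`DwQ`. [cite: Yu1989, §3] -/
def qΔ3 (J₀ J : ℕ) (u : Idx Q.d h Lb) (τ₀ s : ℕ) : ℚ :=
  DwQ (3 ^ (J₀ - J)) (u.1.1 : ℕ) (u.1.2 : ℕ) h τ₀ (s : ℚ)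

/-- `qΔ3` depends on `u` only through `ρ` (re-indexing does not touch it). [folklore] -/
theorem qΔ3_reidx3 (J₀ J' : ℕ) (ε : Fin Q.d → ℕ) (εθ : ℕ) (v : Idx Q.d h Lb) (τ₀ s : ℕ) :
    Q.qΔ3 J₀ J' (Q.reidx3 ε εθ v) τ₀ s = Q.qΔ3 J₀ J' v τ₀ s := rfl

/-- **The `Δ`-factor of level `J` at the third point `s/3` is `3^{τ₀} · qΔ3_{J+1}(s)`** (`J < J₀`:
the same natural point `3^{J₀−J−1} s` of the finest lattice). [cite: Yu1989, §3] -/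
theorem qΔ3_third {J₀ J : ℕ} (hJ : J < J₀) (u : Idx Q.d h Lb) (τ₀ s : ℕ) :
    DwQ (3 ^ (J₀ - J)) (u.1.1 : ℕ) (u.1.2 : ℕ) h τ₀ ((s : ℚ) / 3) =
      (3 : ℚ) ^ τ₀ * Q.qΔ3 J₀ (J + 1) u τ₀ s := by
  have e : 3 ^ (J₀ - J) = 3 * 3 ^ (J₀ - (J + 1)) := by
    rw [← pow_succ', show J₀ - (J + 1) + 1 = J₀ - J by omega]
  unfold qΔ3
  rw [e, DwQ_three_mul_div_three]

/-- **At the top level the `Δ`-factor is a Hasse derivative of `w_ρ`**: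
`qΔ3_{J₀,J₀}(u, τ₀, s) = τ₀! · ((1/τ₀!) d^{τ₀} wPolyQ r l h)(s)`. [folklore] -/
theorem qΔ3_top_eq (J₀ : ℕ) (u : Idx Q.d h Lb) (τ₀ s : ℕ) :
    Q.qΔ3 J₀ J₀ u τ₀ s =
      (τ₀.factorial : ℚ) * (hasseDeriv τ₀ (wPolyQ (u.1.1 : ℕ) (u.1.2 : ℕ) h)).eval (s : ℚ) := by
  unfold qΔ3
  rw [Nat.sub_self, pow_zero, DwQ_one]

/-- The signed rational core of one term at a natural point, base `3`: `qΔ3 · qA♭ · qE`.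
[cite: CijsouwWaldschmidt1977, §4 (p. 186)] -/
def qTerm3 (J₀ J : ℕ) (u : Idx Q.d h Lb) (τ : Tau Q.d) (s : ℕ) : ℚ :=
  Q.qΔ3 J₀ J u τ.1 s * Q.flat.qA u τ.2 * Q.qE u s

/-- **The signed rational core of `φ_{J,τ}(s)` at base `3`**: `coreSum3 = ∑_u p(u) · qTerm3`.
[cite: CijsouwWaldschmidt1977, §4 (p. 186)] -/
def coreSum3 (J₀ J : ℕ) (box : Finset (Idx Q.d h Lb)) (p : Idx Q.d h Lb → ℤ) (τ : Tau Q.d)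
    (s : ℕ) : ℚ :=
  ∑ u ∈ box, (p u : ℚ) * Q.qTerm3 J₀ J u τ s

/-! ### Boxes of level `J` (ranges `Lⱼ/3ᴶ`) -/

/-- **The box of level `J` of the triadic descent**: all `ρ`, `λⱼ ≤ Lⱼ/3ᴶ`, `λ_θ ≤ L_θ/3ᴶ`.
[cite: Yu1989, §3] -/
def box3 (L : Fin Q.d → ℕ) (Lθ J : ℕ) : Finset (Idx Q.d h Lb) :=
  univ ×ˢ ((Fintype.piFinset fun j => range (L j / 3 ^ J + 1)) ×ˢ range (Lθ / 3 ^ J + 1))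

/-- Membership in the box of level `J`. [folklore] -/
theorem mem_box3 {L : Fin Q.d → ℕ} {Lθ J : ℕ} {u : Idx Q.d h Lb} :
    u ∈ Q.box3 (h := h) (Lb := Lb) L Lθ J ↔ (∀ j, u.2.1 j ≤ L j / 3 ^ J) ∧ u.2.2 ≤ Lθ / 3 ^ J := by
  unfold box3
  simp only [mem_product, mem_univ, true_and, Fintype.mem_piFinset, mem_range, Nat.lt_succ_iff]

/-- `⌊⌊L/3ᴶ⌋/3⌋ = ⌊L/3^{J+1}⌋`. [folklore] -/
theorem div_pow_div_three (L' J : ℕ) : L' / 3 ^ J / 3 = L' / 3 ^ (J + 1) := by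
  rw [Nat.div_div_eq_div_mul, pow_succ]

/-- `reidx3 v ∈ box3_J ⇒ v ∈ box3_{J+1}`. [cite: Yu1989, §3] -/
theorem mem_box3_succ_of_reidx3 {L : Fin Q.d → ℕ} {Lθ J : ℕ} {ε : Fin Q.d → ℕ} {εθ : ℕ}
    {v : Idx Q.d h Lb} (hv : Q.reidx3 ε εθ v ∈ Q.box3 (h := h) (Lb := Lb) L Lθ J) :
    v ∈ Q.box3 (h := h) (Lb := Lb) L Lθ (J + 1) := by
  rw [Q.mem_box3] at hv ⊢
  simp only [reidx3_snd_fst, reidx3_snd_snd] at hv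
  refine ⟨fun j => ?_, ?_⟩
  · have := hv.1 j; rw [← div_pow_div_three]; omega
  · have := hv.2; rw [← div_pow_div_three]; omega

/-- `third u ∈ box3_{J+1}` for `u ∈ box3_J`. [folklore] -/
theorem third_mem_box3_succ {L : Fin Q.d → ℕ} {Lθ J : ℕ} {u : Idx Q.d h Lb}
    (hu : u ∈ Q.box3 (h := h) (Lb := Lb) L Lθ J) :
    Q.third u ∈ Q.box3 (h := h) (Lb := Lb) L Lθ (J + 1) := by
  rw [Q.mem_box3] at hu ⊢
  unfold third
  simp only
  exact ⟨fun j => by rw [← div_pow_div_three]; exact Nat.div_le_div_right (hu.1 j),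
    by rw [← div_pow_div_three]; exact Nat.div_le_div_right hu.2⟩

/-- The box of the top level has `λ_θ = 0` when `L_θ < 3^{J₀}`. [folklore] -/
theorem mem_box3_top_iff {L : Fin Q.d → ℕ} {Lθ J₀ : ℕ} (hLθ : Lθ < 3 ^ J₀) {u : Idx Q.d h Lb} :
    u ∈ Q.box3 (h := h) (Lb := Lb) L Lθ J₀ ↔ (∀ j, u.2.1 j ≤ L j / 3 ^ J₀) ∧ u.2.2 = 0 := by
  rw [Q.mem_box3, Nat.div_eq_of_lt hLθ, Nat.le_zero]

/-! ### The points `{s < N : 3 ∤ s}` -/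

/-- **The evaluation points below `N`**: the naturals `s < N` prime to `3` (the third points `s/3`
are new points exactly when `3 ∤ s`). [cite: Yu1989, §3] -/
def Pts3 (N : ℕ) : Finset ℕ := (range N).filter fun s => ¬ 3 ∣ s

/-- Membership in `Pts3 N`. [folklore] -/
@[simp] theorem mem_Pts3 {N s : ℕ} : s ∈ Pts3 N ↔ s < N ∧ ¬ 3 ∣ s := by
  unfold Pts3; rw [mem_filter, mem_range]

/-- `Pts3` is monotone. [folklore] -/
theorem Pts3_mono {N N' : ℕ} (hN : N ≤ N') : Pts3 N ⊆ Pts3 N' := fun s hs => by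
  rw [mem_Pts3] at hs ⊢; exact ⟨lt_of_lt_of_le hs.1 hN, hs.2⟩

/-- **The count**: `#{s < 3M : 3 ∤ s} = 2M`. [folklore] -/
theorem card_Pts3_three_mul (M : ℕ) : (Pts3 (3 * M)).card = 2 * M := by
  induction M with
  | zero => simp [Pts3]
  | succ M ih =>
    have hsplit : Pts3 (3 * (M + 1)) = Pts3 (3 * M) ∪ {3 * M + 1, 3 * M + 2} := by
      ext s
      simp only [mem_Pts3, mem_union, mem_insert, mem_singleton]
      omega
    rw [hsplit, card_union_of_disjoint, ih, card_pair (by omega)]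
    · ring
    · rw [disjoint_iff_ne]
      intro a ha b hb
      rw [mem_Pts3] at ha
      simp only [mem_insert, mem_singleton] at hb
      omega

/-- The count for `3 ∣ N`: `#{s < N : 3 ∤ s} = 2 (N/3)`. [folklore] -/
theorem card_Pts3 {N : ℕ} (hN : 3 ∣ N) : (Pts3 N).card = 2 * (N / 3) := by
  obtain ⟨M, rfl⟩ := hN
  rw [card_Pts3_three_mul, Nat.mul_div_cancel_left _ (by norm_num : 0 < 3)]

/-- A lower bound for every `N`: `2 ⌊N/3⌋ ≤ #{s < N : 3 ∤ s}`. [folklore] -/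
theorem two_mul_div_le_card_Pts3 (N : ℕ) : 2 * (N / 3) ≤ (Pts3 N).card := by
  rw [← card_Pts3_three_mul]
  exact card_le_card (Pts3_mono (Nat.mul_div_le N 3))

/-! ### Residues modulo `3` at a point prime to `3` -/

/-- For `3 ∤ s`: `n s ≡ e s (mod 3) ⟺ n ≡ e (mod 3)` (`s` is a unit mod `3`). [folklore] -/
theorem mul_mod_three_eq_iff {s : ℕ} (hs : ¬ 3 ∣ s) (n e : ℕ) :
    n * s % 3 = e * s % 3 ↔ n % 3 = e % 3 := by
  have hs' : s % 3 = 1 ∨ s % 3 = 2 := by omega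
  rw [Nat.mul_mod n s, Nat.mul_mod e s]
  rcases hs' with h1 | h2
  · rw [h1, mul_one, mul_one, Nat.mod_mod, Nat.mod_mod]
  · rw [h2]
    have hn : n % 3 < 3 := Nat.mod_lt _ (by norm_num)
    have he : e % 3 < 3 := Nat.mod_lt _ (by norm_num)
    constructor
    · intro h; interval_cases (n % 3) <;> interval_cases (e % 3) <;> simp_all
    · intro h; rw [h]

/-- **The class pattern of a residue vector**: `clsPat3 ε ε_θ s = (εᵢ s mod 3)ᵢ`, the triadic class
of every unknown with residues `(ε, ε_θ)` at the point `s` (`cls3_reidx3`). [cite: Yu1989, §3] -/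
def clsPat3 (ε : Fin Q.d → ℕ) (εθ s : ℕ) : Fin (Q.d + 1) → Fin 3 :=
  fun i => ⟨Q.flat.resVec ε εθ i * s % 3, Nat.mod_lt _ (by norm_num)⟩

/-- Components of `clsPat3`. [folklore] -/
@[simp] theorem clsPat3_val (ε : Fin Q.d → ℕ) (εθ s : ℕ) (i : Fin (Q.d + 1)) :
    ((Q.clsPat3 ε εθ s i : Fin 3) : ℕ) = Q.flat.resVec ε εθ i * s % 3 := rfl

/-- **For `3 ∤ s`, the class of `u` at `s` is the pattern of `u`'s residues**:
`cls3 u s = clsPat3 ε ε_θ s` iff `λⱼ ≡ εⱼ`, `λ_θ ≡ ε_θ (mod 3)` (residues `≤ 2`).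
[cite: Yu1989, §3] -/
theorem cls3_eq_clsPat3_iff {s : ℕ} (hs : ¬ 3 ∣ s) {ε : Fin Q.d → ℕ} {εθ : ℕ} (hε : ∀ j, ε j ≤ 2)
    (hεθ : εθ ≤ 2) (u : Idx Q.d h Lb) :
    Q.cls3 u s = Q.clsPat3 ε εθ s ↔ (∀ j, u.2.1 j % 3 = ε j) ∧ u.2.2 % 3 = εθ := by
  constructor
  · intro heq
    have key : ∀ i : Fin (Q.d + 1), Q.flat.expn u s i % 3 = Q.flat.resVec ε εθ i * s % 3 := by
      intro i
      have h1 := congrArg (fun f => ((f i : Fin 3) : ℕ)) heq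
      simpa using h1
    refine ⟨fun j => ?_, ?_⟩
    · have h1 := key (Fin.castSucc j)
      rw [Q.flat_expn_castSucc, Q.flat_resVec_castSucc, mul_mod_three_eq_iff hs] at h1
      rw [h1]; exact Nat.mod_eq_of_lt (by have := hε j; omega)
    · have h1 := key (Fin.last Q.d)
      rw [Q.flat_expn_last, Q.flat_resVec_last, mul_mod_three_eq_iff hs] at h1
      rw [h1]; exact Nat.mod_eq_of_lt (by omega)
  · rintro ⟨hj, hθ⟩
    funext i
    apply Fin.ext
    rw [Q.cls3_val, Q.clsPat3_val]
    refine Fin.lastCases ?_ (fun j => ?_) i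
    · rw [Q.flat_expn_last, Q.flat_resVec_last, mul_mod_three_eq_iff hs, hθ]
      exact (Nat.mod_eq_of_lt (by omega)).symm
    · rw [Q.flat_expn_castSucc, Q.flat_resVec_castSucc, mul_mod_three_eq_iff hs, hj j]
      exact (Nat.mod_eq_of_lt (by have := hε j; omega)).symm

/-- The residues of `reidx3 ε ε_θ v` are `(ε, ε_θ)`. [folklore] -/
theorem reidx3_mod_three {ε : Fin Q.d → ℕ} {εθ : ℕ} (hε : ∀ j, ε j ≤ 2) (hεθ : εθ ≤ 2)
    (v : Idx Q.d h Lb) :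
    (∀ j, (Q.reidx3 ε εθ v).2.1 j % 3 = ε j) ∧ (Q.reidx3 ε εθ v).2.2 % 3 = εθ := by
  simp only [reidx3_snd_fst, reidx3_snd_snd]
  exact ⟨fun j => by have := hε j; omega, by omega⟩

/-- **Summing over a residue class = summing over the re-indexed box of the next level** (`3 ∤ s`).
[cite: Yu1989, §3] -/
theorem sum_class3_eq_sum_reidx3 {s : ℕ} (hs : ¬ 3 ∣ s) {ε : Fin Q.d → ℕ} {εθ : ℕ}
    (hε : ∀ j, ε j ≤ 2) (hεθ : εθ ≤ 2) (L : Fin Q.d → ℕ) (Lθ J : ℕ) (G : Idx Q.d h Lb → ℚ) :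
    ∑ u ∈ Q.box3 (h := h) (Lb := Lb) L Lθ J with Q.cls3 u s = Q.clsPat3 ε εθ s, G u =
      ∑ v ∈ Q.box3 (h := h) (Lb := Lb) L Lθ (J + 1) with
        Q.reidx3 ε εθ v ∈ Q.box3 (h := h) (Lb := Lb) L Lθ J, G (Q.reidx3 ε εθ v) := by
  refine Finset.sum_nbij' Q.third (Q.reidx3 ε εθ) ?_ ?_ ?_ ?_ ?_
  · intro u hu
    rw [mem_filter] at hu ⊢
    obtain ⟨hub, hus⟩ := hu
    have hpar := (Q.cls3_eq_clsPat3_iff hs hε hεθ u).mp hus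
    refine ⟨Q.third_mem_box3_succ hub, ?_⟩
    rw [Q.reidx3_third u hpar.1 hpar.2]; exact hub
  · intro v hv
    rw [mem_filter] at hv ⊢
    exact ⟨hv.2, (Q.cls3_eq_clsPat3_iff hs hε hεθ _).mpr (Q.reidx3_mod_three hε hεθ v)⟩
  · intro u hu
    rw [mem_filter] at hu
    have hpar := (Q.cls3_eq_clsPat3_iff hs hε hεθ u).mp hu.2
    exact Q.reidx3_third u hpar.1 hpar.2
  · intro v _
    exact Q.third_reidx3 hε hεθ v
  · intro u hu
    rw [mem_filter] at hu
    have hpar := (Q.cls3_eq_clsPat3_iff hs hε hεθ u).mp hu.2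
    rw [Q.reidx3_third u hpar.1 hpar.2]

/-! ### The effect of the re-indexing `λ = ε + 3μ` on the coefficients -/

/-- The recentring constants of the triadic descent: `cⱼ = (εⱼ + ε_θ βⱼ)/3`. [cite: Yu1989, §3] -/
def cγ3 (ε : Fin Q.d → ℕ) (εθ : ℕ) (j : Fin Q.d) : ℚ := ((ε j : ℚ) + (εθ : ℚ) * Q.flat.β j) / 3

/-- **`γⱼ(ε + 3μ) = 3 (γⱼ(μ) + cⱼ)`.** [cite: Yu1989, §3] -/
theorem γ_reidx3 (ε : Fin Q.d → ℕ) (εθ : ℕ) (v : Idx Q.d h Lb) (j : Fin Q.d) :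
    Q.flat.γ (Q.reidx3 ε εθ v) j = 3 * (Q.flat.γ v j + Q.cγ3 ε εθ j) := by
  unfold CW77.Setup.γ cγ3
  rw [Q.reidx3_snd_fst, Q.reidx3_snd_snd]
  push_cast; ring

/-- `qA♭(ε + 3μ, τ') = 3^{|τ'|} ∏ⱼ (γⱼ(μ) + cⱼ)^{τ'ⱼ}`. [cite: Yu1989, §3] -/
theorem qA_reidx3 (ε : Fin Q.d → ℕ) (εθ : ℕ) (v : Idx Q.d h Lb) (τ' : Fin Q.d → ℕ) :
    Q.flat.qA (Q.reidx3 ε εθ v) τ' = 3 ^ (∑ j, τ' j) * ∏ j, (Q.flat.γ v j + Q.cγ3 ε εθ j) ^ τ' j := by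
  unfold CW77.Setup.qA
  simp_rw [Q.γ_reidx3, mul_pow]
  rw [prod_mul_distrib, Finset.prod_pow_eq_pow_sum]

/-! ### The invariant of the triadic descent -/

/-- **The induction invariant of the triadic descent at level `J`**: integers `p(u)`, supported in
the box of level `J`, not all zero, bounded by `P`, with the relations `coreSum3_{J,τ}(s) = 0` for all
`s < 3ᴶ S₀` with `3 ∤ s` and all `|τ| < T/3ᴶ`. [cite: Yu1989, §3 (the main inductive argument)] -/
structure Inv3 (J₀ : ℕ) (L : Fin Q.d → ℕ) (Lθ S₀ T : ℕ) (P : ℤ) (J : ℕ) (p : Idx Q.d h Lb → ℤ) :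
    Prop where
  /-- support in the box of level `J` -/
  supp : ∀ u, p u ≠ 0 → u ∈ Q.box3 (h := h) (Lb := Lb) L Lθ J
  /-- not all zero -/
  nonzero : ∃ u, p u ≠ 0
  /-- the size bound -/
  bound : ∀ u, |p u| ≤ P
  /-- the relations -/
  rel : ∀ s, s < 3 ^ J * S₀ → ¬ 3 ∣ s → ∀ τ : Tau Q.d, tauNorm τ < T / 3 ^ J →
    Q.coreSum3 J₀ J (Q.box3 (h := h) (Lb := Lb) L Lθ J) p τ s = 0

end SetupQ

end Summit.ABC.StewartYu

end
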